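import Mathlib
import HarnessLib
import Summits.HubbardSuperconductivity.HubbardSuperconductivity.Theorems.KLProgrammeKLRegimeCountertermJacksonRemainderMeanFree
import Summits.HubbardSuperconductivity.HubbardSuperconductivity.Theorems.KLProgrammeKLRegimeCountertermJacksonRemainderFlowSizes

/-!
# Route `KLProgramme`, crux K3 — gen-8 ENGINE-FLOW child (stmt-HubbardSuperconductivity-20437 `KLRegimeEngineV17F2`), stub (C)
# `stub_twoLeg_curvature`, door (C1) part 6: the ONE-CALL form — jets of `R = (klFlowPiece n).eval ∘ k_F^{K′} − ν_n(K_n)` from the ANGULAR DATA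
# of the reading and THREE NUMBERS at the curve point

Seat hubbard-kl-k3c3-p1 (g5).  Composition of part 5 (`flowPiece_reading_remainder_jets_meanFree`, p536588), part 4 (`localSizes_onM_klFrameExtFn_of_ball`,
p536097) and k3c3-p1 g2's global bound `norm_iteratedFDeriv_onM_klFrameExtFn_le` — all at the MEAN-FREE profile `f − mean f`, `f = ν_n(K_n)`:

* inputs: `‖Dᵏf‖ ≤ a k` (`1 ≤ k ≤ 4`), `|f − mean f| ≤ G₀`, one `G ≥ ‖Dⁱ(f − mean f)‖` (`i ≤ 4`, for the cutoff-zone GLOBAL sizes), the `χ₂` numeral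
  `‖Dˡ salmhoferCutoff‖ ≤ X` (`l ≤ 4`), the centre numbers `|ε(x) − μ| + 4r < klFlatR`, `|xᵢ| + r < π`, `ρ + r ≤ ‖x‖` at `x = k_F^{K′}(θ)`, the margin
  `0 < δ ≤ π`, `2δ ≤ r`, honest curve jets `‖γ^{(i)}(θ)‖ ≤ Dⁱ`, a first-moment bound `m₁`, and `hon` (the extension reads `f` on `K′`'s curve);
* output: **`flowPiece_reading_remainder_jets_oneCall`** — the value and the four jet bounds of part 3/5 with
  `Ml = (G₀ | a₁/ρ | (a₂+a₁)/ρ² | (a₃+3a₂+2a₁)/ρ³ | (a₄+6a₃+11a₂+6a₁)/ρ⁴)` and `B i = (i!)²·(2·i!·X·200ⁱ)·G·(4 + max 1 ((i−1)!/(8/5)))ⁱ` (no `|mean|`).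

Bookkeeping only; no definitions; nothing about the model; nothing here asserts superconductivity.
-/

noncomputable section

namespace Summit.HubbardSuperconductivity.HubbardSuperconductivity.Theorems.KLRegimeSplit

set_option linter.dupNamespace false -- summit = problem name (single-conjunct summit), D-0017

open Real MeasureTheory Filter
open Literature.Analysis.Fourier.TrigApprox Literature.MathematicalPhysics.QuantumLattice
open Summit.HubbardSuperconductivity.HubbardSuperconductivity.Theorems.PerturbedFermiCurve

section OneCall

variable {L M : ℕ} [NeZero L] [NeZero M]

omit [NeZero L] [NeZero M] in
/-- The mean-free profile's own mean-free part is itself: `(f − mean f) − mean(f − mean f) = f − mean f`. -/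
theorem sub_mean_sub_mean_eq {f : ℝ → ℝ} (hf : IntervalIntegrable f volume 0 (2 * π)) :
    (fun t => (f t - klAngularMean f) - klAngularMean (fun t => f t - klAngularMean f)) = fun t => f t - klAngularMean f := by
  funext t; rw [klAngularMean_sub_mean f hf, sub_zero]

/-- **GLOBAL sizes of the mean-free extension** (k3c3-p1 g2's bound at `f − mean f`: the `|mean|` term vanishes):
`‖Dⁱ onM (E_μ(f − mean f))‖ ≤ (i!)²·(2·i!·X·200ⁱ)·G·(4 + max 1 ((i−1)!/(8/5)))ⁱ` for `i ≤ 4`. -/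
theorem norm_iteratedFDeriv_onM_klFrameExtFn_meanFree_le {f : ℝ → ℝ} (hf : ContDiff ℝ 4 f) (hper : Function.Periodic f (2 * Real.pi))
    {μ : ℝ} (hμ : μ ∈ klWindowC) {G X : ℝ} (hG : ∀ i ≤ 4, ∀ t : ℝ, ‖iteratedFDeriv ℝ i (fun t => f t - klAngularMean f) t‖ ≤ G)
    (hX : ∀ l ≤ 4, ∀ x : ℝ, ‖iteratedFDeriv ℝ l salmhoferCutoff x‖ ≤ X) {i : ℕ} (hi : i ≤ 4) (q : Momentum) :
    ‖iteratedFDeriv ℝ i (onM (klFrameExtFn μ fun t => f t - klAngularMean f)) q‖ ≤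
      (i.factorial : ℝ) ^ 2 * (2 * i.factorial * X * 200 ^ i) * G * (4 + max 1 (((i - 1).factorial : ℝ) / (8 / 5))) ^ i := by
  have hfi : IntervalIntegrable f volume 0 (2 * π) := hf.continuous.intervalIntegrable _ _
  have hg : ContDiff ℝ 4 (fun t : ℝ => f t - klAngularMean f) := hf.sub contDiff_const
  have hgper : Function.Periodic (fun t : ℝ => f t - klAngularMean f) (2 * Real.pi) := fun t => by
    show f (t + 2 * Real.pi) - klAngularMean f = f t - klAngularMean f
    rw [hper t]
  have hG' : ∀ j ≤ i, ∀ t : ℝ, ‖iteratedFDeriv ℝ j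
      (fun t => (f t - klAngularMean f) - klAngularMean (fun t => f t - klAngularMean f)) t‖ ≤ G := by
    intro j hj t
    rw [sub_mean_sub_mean_eq hfi]
    exact hG j (hj.trans hi) t
  have hX' : ∀ l ≤ i, ∀ x : ℝ, ‖iteratedFDeriv ℝ l salmhoferCutoff x‖ ≤ X := fun l hl x => hX l (hl.trans hi) x
  have h := norm_iteratedFDeriv_onM_klFrameExtFn_le (N := 4) hg hgper (n := i) (by exact_mod_cast hi) hμ hG' hX' q
  rw [klAngularMean_sub_mean f hfi, abs_zero] at h
  simpa using h

/-- **THE (C1) DOOR, ONE CALL.**  `f := ν_n(K_n)` (`C⁴`), `K′` any frame whose Fermi points the extension reads (`hon`), `x := k_F^{K′}(θ)` read in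
`EuclideanSpace`, `γ := toLp ∘ k_F^{K′}` with honest jets `‖γ^{(i)}(θ)‖ ≤ Dⁱ`; angular data `‖Dᵏf‖ ≤ a k` (`1 ≤ k ≤ 4`), `|f − mean f| ≤ G₀`,
`‖Dⁱ(f − mean f)‖ ≤ G` (`i ≤ 4`), `χ₂` numeral `X`; centre numbers `|ε(x) − μ| + 4r < klFlatR`, `|xᵢ| + r < π`, `ρ + r ≤ ‖x‖`; margin `0 < δ ≤ π`,
`2δ ≤ r`; first moment `m₁`.  With `τ := π³/((d+1)δ)³`, `d = klFlowDeg n`, `Ml = (G₀, a₁/ρ, (a₂+a₁)/ρ², (a₃+3a₂+2a₁)/ρ³, (a₄+6a₃+11a₂+6a₁)/ρ⁴)`,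
`B i = (i!)²(2·i!·X·200ⁱ)·G·(4 + max 1 ((i−1)!/(8/5)))ⁱ`, `Qₗ = Ml (l+1)·m₁ + (B l + Ml l)·τ` (`l ≤ 3`), `Q₄ = 2Ml 4 + B 4·τ`:
`|R θ| ≤ Ml 1·m₁ + (B 0 + Ml 0)τ`, `|R′| ≤ Q₁D`, `|R″| ≤ (Q₂+Q₁)D²`, `|R‴| ≤ (Q₃+3Q₂+Q₁)D³`, `|R⁗| ≤ (Q₄+6Q₃+7Q₂+Q₁)D⁴`. -/
theorem flowPiece_reading_remainder_jets_oneCall (β U : ℝ) {μ : ℝ} (hμ : μ ∈ klWindowC) (n : ℕ) (K' : TrigPolyC4v)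
    (hf : ContDiff ℝ 4 fun θ : ℝ => klLocalPart L M β U μ (klFlowFrameU L M β U μ n) n θ)
    (hon : ∀ θ, klFrameExtFn μ (fun θ => klLocalPart L M β U μ (klFlowFrameU L M β U μ n) n θ) (klFermiPoint μ K' θ) =
      klLocalPart L M β U μ (klFlowFrameU L M β U μ n) n θ)
    (hγ : ContDiff ℝ 4 fun θ => (WithLp.toLp 2 (klFermiPoint μ K' θ) : EuclideanSpace ℝ (Fin 2)))
    {θ r ρ δ D G₀ G X m₁ : ℝ} {a : ℕ → ℝ}
    (ha : ∀ k, 1 ≤ k → k ≤ 4 → ∀ t : ℝ,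
      ‖iteratedFDeriv ℝ k (fun θ : ℝ => klLocalPart L M β U μ (klFlowFrameU L M β U μ n) n θ) t‖ ≤ a k)
    (hG₀ : ∀ t : ℝ, |klLocalPart L M β U μ (klFlowFrameU L M β U μ n) n t -
      klAngularMean (fun θ : ℝ => klLocalPart L M β U μ (klFlowFrameU L M β U μ n) n θ)| ≤ G₀)
    (hG : ∀ i ≤ 4, ∀ t : ℝ, ‖iteratedFDeriv ℝ i (fun t => klLocalPart L M β U μ (klFlowFrameU L M β U μ n) n t -
      klAngularMean (fun θ : ℝ => klLocalPart L M β U μ (klFlowFrameU L M β U μ n) n θ)) t‖ ≤ G)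
    (hX : ∀ l ≤ 4, ∀ x : ℝ, ‖iteratedFDeriv ℝ l salmhoferCutoff x‖ ≤ X)
    (hρ : 0 < ρ)
    (htube : |sqDispersion (WithLp.ofLp (WithLp.toLp 2 (klFermiPoint μ K' θ) : EuclideanSpace ℝ (Fin 2))) - μ| + 4 * r < klFlatR)
    (hcell : ∀ i, |WithLp.ofLp (WithLp.toLp 2 (klFermiPoint μ K' θ) : EuclideanSpace ℝ (Fin 2)) i| + r < π)
    (hrad : ρ + r ≤ ‖(WithLp.toLp 2 (klFermiPoint μ K' θ) : EuclideanSpace ℝ (Fin 2))‖)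
    (hδ : 0 < δ) (hδπ : δ ≤ π) (hδr : 2 * δ ≤ r) (hm₁ : ∫ w, jweight (klFlowDeg n) w * (|w.1| + |w.2|) ∂jmeas ≤ m₁)
    (hD : ∀ i, 1 ≤ i → i ≤ 4 →
      ‖iteratedDeriv i (fun θ => (WithLp.toLp 2 (klFermiPoint μ K' θ) : EuclideanSpace ℝ (Fin 2))) θ‖ ≤ D ^ i) :
    let Ml : ℕ → ℝ := fun i => match i with
      | 0 => G₀
      | 1 => a 1 / ρ
      | 2 => (a 2 + a 1) / ρ ^ 2
      | 3 => (a 3 + 3 * a 2 + 2 * a 1) / ρ ^ 3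
      | _ => (a 4 + 6 * a 3 + 11 * a 2 + 6 * a 1) / ρ ^ 4
    let B : ℕ → ℝ := fun i => (i.factorial : ℝ) ^ 2 * (2 * i.factorial * X * 200 ^ i) * G * (4 + max 1 (((i - 1).factorial : ℝ) / (8 / 5))) ^ i
    let τ : ℝ := π ^ 3 / ((klFlowDeg n + 1) * δ) ^ 3
    |(klFlowPiece L M β U μ n).eval (klFermiPoint μ K' θ) - klLocalPart L M β U μ (klFlowFrameU L M β U μ n) n θ| ≤
      Ml 1 * m₁ + (B 0 + Ml 0) * τ ∧
    |iteratedDeriv 1 (fun θ => (klFlowPiece L M β U μ n).eval (klFermiPoint μ K' θ) -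
        klLocalPart L M β U μ (klFlowFrameU L M β U μ n) n θ) θ| ≤ (Ml 2 * m₁ + (B 1 + Ml 1) * τ) * D ∧
    |iteratedDeriv 2 (fun θ => (klFlowPiece L M β U μ n).eval (klFermiPoint μ K' θ) -
        klLocalPart L M β U μ (klFlowFrameU L M β U μ n) n θ) θ| ≤
      ((Ml 3 * m₁ + (B 2 + Ml 2) * τ) + (Ml 2 * m₁ + (B 1 + Ml 1) * τ)) * D ^ 2 ∧
    |iteratedDeriv 3 (fun θ => (klFlowPiece L M β U μ n).eval (klFermiPoint μ K' θ) -
        klLocalPart L M β U μ (klFlowFrameU L M β U μ n) n θ) θ| ≤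
      ((Ml 4 * m₁ + (B 3 + Ml 3) * τ) + 3 * (Ml 3 * m₁ + (B 2 + Ml 2) * τ) + (Ml 2 * m₁ + (B 1 + Ml 1) * τ)) * D ^ 3 ∧
    |iteratedDeriv 4 (fun θ => (klFlowPiece L M β U μ n).eval (klFermiPoint μ K' θ) -
        klLocalPart L M β U μ (klFlowFrameU L M β U μ n) n θ) θ| ≤
      ((2 * Ml 4 + B 4 * τ) + 6 * (Ml 4 * m₁ + (B 3 + Ml 3) * τ) + 7 * (Ml 3 * m₁ + (B 2 + Ml 2) * τ) +
        (Ml 2 * m₁ + (B 1 + Ml 1) * τ)) * D ^ 4 := by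
  intro Ml B τ
  set f : ℝ → ℝ := fun θ => klLocalPart L M β U μ (klFlowFrameU L M β U μ n) n θ with hfdef
  have hper : Function.Periodic f (2 * Real.pi) := klLocalPart_periodic β U μ _ n
  have hfi : IntervalIntegrable f volume 0 (2 * π) := hf.continuous.intervalIntegrable _ _
  have hg : ContDiff ℝ 4 (fun t : ℝ => f t - klAngularMean f) := hf.sub contDiff_const
  have hgper : Function.Periodic (fun t : ℝ => f t - klAngularMean f) (2 * Real.pi) := fun t => by
    show f (t + 2 * Real.pi) - klAngularMean f = f t - klAngularMean f
    rw [hper t]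
  -- global sizes of the mean-free extension
  have hB : ∀ i ≤ 4, ∀ y, ‖iteratedFDeriv ℝ i (onM (klFrameExtFn μ fun t => f t - klAngularMean f)) y‖ ≤ B i :=
    fun i hi y => norm_iteratedFDeriv_onM_klFrameExtFn_meanFree_le hf hper hμ hG hX hi y
  -- local sizes on the ball, at the mean-free profile
  have ha' : ∀ k, 1 ≤ k → k ≤ 4 → ∀ t : ℝ, ‖iteratedFDeriv ℝ k (fun t => f t - klAngularMean f) t‖ ≤ a k := by
    intro k hk1 hk4 t
    rw [norm_iteratedFDeriv_sub_const_of_one_le f _ hk1]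
    exact ha k hk1 hk4 t
  have hG₀' : ∀ t : ℝ, |(f t - klAngularMean f) - klAngularMean (fun t => f t - klAngularMean f)| ≤ G₀ := by
    intro t
    rw [klAngularMean_sub_mean f hfi, sub_zero]
    exact hG₀ t
  have hMl : ∀ i ≤ 4, ∀ y : EuclideanSpace ℝ (Fin 2), ‖y - WithLp.toLp 2 (klFermiPoint μ K' θ)‖ ≤ r →
      ‖iteratedFDeriv ℝ i (onM (klFrameExtFn μ fun t => f t - klAngularMean f)) y‖ ≤ Ml i := by
    intro i hi y hy
    have h := localSizes_onM_klFrameExtFn_of_ball hg hgper hρ htube hcell hrad ha' hG₀' hi y hy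
    rw [klAngularMean_sub_mean f hfi, abs_zero, zero_add] at h
    interval_cases i <;> exact h
  exact flowPiece_reading_remainder_jets_meanFree (L := L) (M := M) β U hμ n K' hf hon hB hγ hMl hδ hδπ hδr hm₁ hD

end OneCall

end Summit.HubbardSuperconductivity.HubbardSuperconductivity.Theorems.KLRegimeSplit

end
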